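import Literature.Analysis.OperatorTheory.SimpleEigenvalueHolomorphic
import Literature.Analysis.OperatorTheory.RieszProjectionEigenbasis
import Literature.Analysis.OperatorTheory.RieszProjectionCompact
import HarnessLib

/-!
# The scalar of a Riesz projection is the eigenvalue inside the circle (Kato III-§6.5)

Analysis/OperatorTheory proofs-layer file (theorems only, no definitions, no named facts),
rounding off `SimpleEigenvalueHolomorphic.lean`: there `T P = μ P` was obtained for the Riesz
projection `P = P[T]` over a circle when `P` has rank one, with `μ` holomorphic along holomorphic
families; here we identify the scalar `μ` spectrally (Kato III-§6.5: for an isolated eigenvalue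
`λ` with `dim M′ = 1`, `T_{M′} = λ`, i.e. `TP = λP`, and `Σ′ = {λ}`):

* `apply_eq_smul_of_mul_eq_smul`: `T P = μ P ⇒ T (P u) = μ (P u)` — every vector of `Ran P` is an
  eigenvector (or zero);
* `mem_spectrum_of_mul_eq_smul`: `T P = μ P`, `P ≠ 0 ⇒ μ ∈ σ(T)`;
* **`mem_ball_of_mul_rieszProjection_eq_smul`**: for the Riesz projection over a circle in `ρ(T)`,
  `T P = μ P` and `P ≠ 0` force `μ` to lie INSIDE the circle (an eigenvector with eigenvalue
  outside would be killed by `P`, `RieszProjectionEigenbasis.lean`, but `P` fixes its range);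
* `eq_of_apply_eq_smul_of_mem_ball`: conversely every eigenvalue of `T` inside the circle equals
  `μ` (restated from `eigenvalue_branch_eq_of_apply_eq_smul` in the symmetric form);
* **`spectrum_inter_ball_eq_singleton`**: for a COMPACT `T` and a circle not enclosing `0`,
  `σ(T) ∩ ball c R = {μ}` (Fredholm alternative: non-zero spectral points are eigenvalues);
* `eigenvalue_branch_mem_ball`, `spectrum_inter_ball_eq_singleton_eigenvalue_branch`: the same
  along the holomorphic branch of `exists_eigenvalue_branch` — on the whole ball of parameters the
  branch `λ(ϰ)` stays inside the circle and is the only spectrum of `T(ϰ)` there (Kato VII-§1.3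
  Thm. 1.8: "the eigenvalue problem for `T(ϰ)` in `M′(ϰ)`").

## Mathlib / tree search

Tree: `rieszProjection_apply_of_apply_eq_smul_of_not_mem_ball`, `rieszProjection_mul_self`,
`mem_spectrum_of_apply_eq_smul`, `exists_eigenvector_of_mem_spectrum_of_isCompactOperator`,
`eigenvalue_branch_eq_of_apply_eq_smul`, `exists_eigenvalue_branch`; Mathlib:
`IsCompactOperator.hasEigenvalue_iff_mem_spectrum`. Searched `spectrum_inter_ball_eq_singleton` — none.

## References

* T. Kato, *Perturbation Theory for Linear Operators*, Springer 1966, III-§6.5 (isolated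
  eigenvalues, `dim M′ < ∞`), III-§6.7 Thm. 6.26, VII-§1.3 Thm. 1.8. [Kato1966]
-/

noncomputable section

open Complex Metric Set Filter Topology

namespace Literature.Analysis.OperatorTheory

section Operator

variable {E : Type*} [NormedAddCommGroup E] [NormedSpace ℂ E]

/-- `T P = μ P ⇒ T (P u) = μ • P u`. [cite: Kato1966, III-§6.5] -/
theorem apply_eq_smul_of_mul_eq_smul {T P : E →L[ℂ] E} {μ : ℂ} (h : T * P = μ • P) (u : E) :
    T (P u) = μ • P u := by
  have h1 := congrArg (fun A : E →L[ℂ] E => A u) h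
  simpa [mul_apply_eq_comp, smul_apply] using h1

/-- **`T P = μ P` with `P ≠ 0` puts `μ` in the spectrum** (any `P u ≠ 0` is an eigenvector).
[cite: Kato1966, III-§6.5] -/
theorem mem_spectrum_of_mul_eq_smul [CompleteSpace E] {T P : E →L[ℂ] E} {μ : ℂ}
    (h : T * P = μ • P) (hP : P ≠ 0) : μ ∈ spectrum ℂ T := by
  obtain ⟨u, hu⟩ : ∃ u : E, P u ≠ 0 := by
    by_contra hcon
    push Not at hcon
    exact hP (ContinuousLinearMap.ext fun x => by simpa using hcon x)
  exact mem_spectrum_of_apply_eq_smul (apply_eq_smul_of_mul_eq_smul h u) hu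

variable [CompleteSpace E]

/-- **The scalar of a non-zero Riesz projection lies inside the circle.** If the circle
`|z − c| = R` (`R > 0`) lies in `ρ(T)`, `P = P[T]` is its Riesz projection, `P ≠ 0` and
`T P = μ P`, then `|μ − c| < R` (`P u ≠ 0` is an eigenvector with eigenvalue `μ` and `P (P u) = P u`;
an eigenvalue not inside the circle would give `P (P u) = 0`). [cite: Kato1966, III-§6.4 Thm. 6.17 (6.19) and III-§6.5] -/
theorem mem_ball_of_mul_rieszProjection_eq_smul {T : E →L[ℂ] E} {c : ℂ} {R : ℝ} (hR : 0 < R)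
    (hs : sphere c R ⊆ resolventSet ℂ T) {μ : ℂ}
    (h : T * rieszProjection T c R = μ • rieszProjection T c R) (hP : rieszProjection T c R ≠ 0) :
    μ ∈ ball c R := by
  obtain ⟨u, hu⟩ : ∃ u : E, rieszProjection T c R u ≠ 0 := by
    by_contra hcon
    push Not at hcon
    exact hP (ContinuousLinearMap.ext fun x => by simpa using hcon x)
  by_contra hμ
  have hv : T (rieszProjection T c R u) = μ • rieszProjection T c R u := apply_eq_smul_of_mul_eq_smul h u
  have h0 := rieszProjection_apply_of_apply_eq_smul_of_not_mem_ball hv hu hR.le hμ hs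
  have hPP := congrArg (fun A : E →L[ℂ] E => A u) (rieszProjection_mul_self hR hs)
  simp only [mul_apply_eq_comp] at hPP
  exact hu (hPP ▸ h0)

/-- **Uniqueness inside the circle**: every eigenvalue `ν` of `T` inside the circle equals the
scalar `μ` of the Riesz projection (`P w = w` for its eigenvector, then `T w = μ w`).
[cite: Kato1966, III-§6.5] -/
theorem eq_of_apply_eq_smul_of_mem_ball {T : E →L[ℂ] E} {c : ℂ} {R : ℝ}
    (hs : sphere c R ⊆ resolventSet ℂ T) {μ ν : ℂ} {w : E} (hw : T w = ν • w) (hw0 : w ≠ 0)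
    (hν : ν ∈ ball c R) (h : T * rieszProjection T c R = μ • rieszProjection T c R) : ν = μ :=
  (eigenvalue_branch_eq_of_apply_eq_smul hw hw0 hν hs h).symm

/-- **`σ(T) ∩ {|z − c| < R} = {μ}` for a compact operator.** If `T` is compact, the circle
(`R > 0`) lies in `ρ(T)` and does not enclose `0` (`R ≤ |c|`), `P[T] ≠ 0` and `T P[T] = μ P[T]`,
then `μ` is the only point of the spectrum inside the circle (non-zero spectral points of a
compact operator are eigenvalues, Kato III-§6.7 Thm. 6.26). [cite: Kato1966, III-§6.5 and III-§6.7 Thm. 6.26] -/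
theorem spectrum_inter_ball_eq_singleton {T : E →L[ℂ] E} (hT : IsCompactOperator T) {c : ℂ}
    {R : ℝ} (hR : 0 < R) (hRc : R ≤ ‖c‖) (hs : sphere c R ⊆ resolventSet ℂ T) {μ : ℂ}
    (h : T * rieszProjection T c R = μ • rieszProjection T c R) (hP : rieszProjection T c R ≠ 0) :
    spectrum ℂ T ∩ ball c R = {μ} := by
  apply Set.eq_singleton_iff_unique_mem.2
  refine ⟨⟨mem_spectrum_of_mul_eq_smul h hP, mem_ball_of_mul_rieszProjection_eq_smul hR hs h hP⟩,
    fun ν hν => ?_⟩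
  have hν0 : ν ≠ 0 := by
    rintro rfl
    have h1 : dist (0 : ℂ) c < R := mem_ball.1 hν.2
    rw [dist_comm, dist_zero_right] at h1
    linarith
  obtain ⟨w, hw0, hw⟩ := exists_eigenvector_of_mem_spectrum_of_isCompactOperator hT hν.1 hν0
  exact eq_of_apply_eq_smul_of_mem_ball hs hw hw0 hν.2 h

end Operator

/-! ### Along the holomorphic branch (Kato VII-§1.3 Thm. 1.8) -/

section Branch

variable {E : Type*} [NormedAddCommGroup E] [NormedSpace ℂ E] [CompleteSpace E]

/-- **The holomorphic branch stays inside the circle**: in the situation of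
`exists_eigenvalue_branch` (circle in `ρ(T ϰ)`, `P[T ϰ]` of rank one, `T ϰ · P[T ϰ] = λ(ϰ) P[T ϰ]`
on the ball of parameters), `|λ(ϰ) − c| < R` and `λ(ϰ) ∈ σ(T ϰ)` for every `ϰ` in the ball.
[cite: Kato1966, VII-§1.3 Thm. 1.8 and III-§6.5] -/
theorem eigenvalue_branch_mem_ball {T : ℂ → E →L[ℂ] E} {c : ℂ} {R : ℝ} (hR : 0 < R) {V : Set ℂ}
    (hres : ∀ a ∈ V, sphere c R ⊆ resolventSet ℂ (T a))
    (hrank : ∀ a ∈ V, Module.finrank ℂ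
      (LinearMap.range ((rieszProjection (T a) c R : E →L[ℂ] E) : E →ₗ[ℂ] E)) = 1)
    {μ : ℂ → ℂ} (hμ : ∀ a ∈ V, T a * rieszProjection (T a) c R = μ a • rieszProjection (T a) c R)
    {a : ℂ} (ha : a ∈ V) : μ a ∈ ball c R ∧ μ a ∈ spectrum ℂ (T a) :=
  ⟨mem_ball_of_mul_rieszProjection_eq_smul hR (hres a ha) (hμ a ha)
      (ne_zero_of_finrank_range_eq_one (hrank a ha)),
    mem_spectrum_of_mul_eq_smul (hμ a ha) (ne_zero_of_finrank_range_eq_one (hrank a ha))⟩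

/-- **The branch is the whole spectrum inside the circle** for compact families (circle not
enclosing `0`): `σ(T ϰ) ∩ ball c R = {λ(ϰ)}` for every `ϰ` in the ball of parameters.
[cite: Kato1966, VII-§1.3 Thm. 1.8 and III-§6.7 Thm. 6.26] -/
theorem spectrum_inter_ball_eq_singleton_eigenvalue_branch {T : ℂ → E →L[ℂ] E} {c : ℂ} {R : ℝ}
    (hR : 0 < R) (hRc : R ≤ ‖c‖) {V : Set ℂ} (hT : ∀ a ∈ V, IsCompactOperator (T a))
    (hres : ∀ a ∈ V, sphere c R ⊆ resolventSet ℂ (T a))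
    (hrank : ∀ a ∈ V, Module.finrank ℂ
      (LinearMap.range ((rieszProjection (T a) c R : E →L[ℂ] E) : E →ₗ[ℂ] E)) = 1)
    {μ : ℂ → ℂ} (hμ : ∀ a ∈ V, T a * rieszProjection (T a) c R = μ a • rieszProjection (T a) c R)
    {a : ℂ} (ha : a ∈ V) : spectrum ℂ (T a) ∩ ball c R = {μ a} :=
  spectrum_inter_ball_eq_singleton (hT a ha) hR hRc (hres a ha) (hμ a ha)
    (ne_zero_of_finrank_range_eq_one (hrank a ha))

end Branch

end Literature.Analysis.OperatorTheory
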